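import Summits.HodgeConjecture.HodgeConjecture.Theorems.Ring2AbelianAllAndreFibreClassCodim
import Literature.AlgebraicGeometry.HodgeTheory.GysinBaseChangeOfKunneth
import Literature.AlgebraicGeometry.HodgeTheory.HyperplaneSectionMonodromySmoothLocus
import HarnessLib

/-!
# Ring 2 · sub-cell AbelianAll (ALL ABELIAN VARIETIES), André axis, part XI — Deligne's kernel
# identity (κ) in the EXTREME degrees is a theorem on the carriers; the relative-dimension-1 rung of
# the Lefschetz-type node (β′ᵖᵗ) is UNCONDITIONAL

HONEST FRAMING (page 1, verbatim): **research route, not a corollary; conditional on HC_CM plus one named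
minimal statement.** Cell line: research route conditional on HC_CM; not a corollary; Q11.4-sentence-2
already refuted in dim ≥ 3. Nothing in this file proves a case of the Hodge conjecture for an abelian variety.
`HC_CM` = `Theses.RankFourFaces.CMAbelianHodge`, `HC_AV` = `Theses.PadicSemiregularLift.HodgeAbelianVarieties`,
item `Theses.RankFourFaces.CMToAbelian` (stmt-16267) OPEN and not closed here. Seat `pub-hodge-ring2-ab-andre-2`,
gen 4; owed item o11 of RING2-MAP §AbelianAll AA2.23 ("κ¹ at d = 1 unconditional: needs `H⁰ = ℂ·1` and
top-degree Gysin injectivity on the carriers") — DONE here; brief (iii) "partial results as theorems".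

## What this part proves (everything below is a theorem; no node, no fact, no binder)

Parts X-b/X-c/X-d reduced the Lefschetz-type `B_min` of the André axis, under the Hodge conjecture for ONE
codimension of `𝒳 × 𝒳`, to the supply node (κ_f) `FibreGysinKernelOn hf` — Deligne's invariant-cycle kernel
identity `j_{t*} j_t^* W = 0 ⟹ j_s^* W = 0` (`W ∈ H²ᵖ(𝒳(ℂ); ℂ)`, `j_t = fiberι f t`, `j_{t*} = fiberGysin`) — which is
TRUE IN PRINT (Deligne 1971, 4.1.1 + 4.2.6) but not a tree theorem in the middle degrees `0 < p < d` (no Leray /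
monodromy on the carriers). This part proves it ON THE CARRIERS in the two extreme degrees, for every compact
pencil `f : 𝒳 ⟶ S` of abelian `d`-folds:

* §1 `fiberGysin_one_ne_zero` — the fibre class `[𝒳_t] = j_{t*} 1 ∈ H²(𝒳(ℂ); ℂ)` is non-zero (Wirtinger: the
  closed immersion `j_t` pushes the fundamental class of the non-empty connected `𝒳_t(ℂ)` forward
  non-trivially, the tree's `complexGysin_one_ne_zero_of_stalkMap_surjective`).
* §2 degree `p = 0`: `H⁰(𝒳(ℂ); ℂ) = ℂ · 1` (`exists_eq_smul_one`), `j_t^* 1 = 1`, `j_{t*}(c · 1) = c · [𝒳_t]`, so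
  `j_{t*} j_t^* W = 0 ⟹ W|_{𝒳_t} = 0` (`map_fiberι_eq_zero_of_fiberGysin_eq_zero_zero`).
* §3 degree `p = d` (top degree of the fibre): **`j_{t*} : H^{2d}(𝒳_t(ℂ); ℂ) → H^{2d+2}(𝒳(ℂ); ℂ)` is injective**
  (`fiberGysin_top_injective`): the cup pairing of the closed oriented manifold `𝒳(ℂ)` is perfect (Hatcher
  Prop. 3.38, the tree's PROVED `isPerfPair_cupPairing_of_field_holds`), so `[𝒳_t] ≠ 0` has a partner
  `x ∈ H^{2d}(𝒳)` with `x ∪ [𝒳_t] = j_{t*} j_t^* x ≠ 0` (projection formula, part V); `H^{2d}(𝒳_t(ℂ); ℂ)` is the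
  line through `j_t^* x` (`exists_eq_smul_of_top`), on which `j_{t*}` is therefore injective.
* §4 hence (κ_f) in degrees `0` and `d` at every fibre (`fibreGysinKernel_zero`, `fibreGysinKernel_top`; change
  of fibre by part X-c's `map_fiberι_eq_zero_of_eq_zero` = André's flatness (A4), a tree theorem), and
  **(κ_f) outright for pencils of relative dimension `d ≤ 1`** (`fibreGysinKernelOn_of_relDim_one`,
  `fibreGysinKernelOn_of_relDim_zero`: for `d = 1` the degrees are `p = 0` and `p = 1 = d`; above `d` the fibres
  have no cohomology).
* §5 **THE `d = 1` RUNG IS UNCONDITIONAL**: for every compact pencil `f : 𝒳 ⟶ S` of elliptic curves (smooth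
  projective surface `𝒳` smoothly fibred in genus-one curves with a section over a smooth projective curve)
  **`fibreClassLefschetzPointwiseOn_relDim_one (hf : IsCompactAbelianPencil f 1) : FibreClassLefschetzPointwiseOn hf`**
  — for each `p ≤ 1` and each `t` an ALGEBRAIC correspondence `T_t` of the surface `𝒳` (a codimension-1 cycle
  class on the fourfold `𝒳 × 𝒳`, algebraic by Lefschetz `(1,1)`, part X-d) with `j_s^*(T_t(W ∪ [𝒳_t])) = j_s^* W`
  for all `W`, `s` — NO binder, NO fact, NO Hodge-conjecture input; the one-`T` node (β′_f) and the graded node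
  (β′)_1 modulo fibre-class constancy (φ) ALONE (`fibreClassLefschetzOn_relDim_one_of_const`,
  `fibreClassLefschetzOnAtRelDim_one_of_const`); the `d = 0` rung likewise (`…_relDim_zero…`).
* §6 the ladder state in one statement (`extremeDegrees_summary`).

HONEST LIMITS. (1) The `d ≤ 1` rungs are DEGENERATE IN CONTENT (by design of the node, which speaks of EVEN
fibre degrees `2p ≤ 2d`: an elliptic curve has only `H⁰` and `H²`): they certify that the typed node, the
carriers (`complexGysin`, complex orientations, `IsAlgebraicCorrespondence`) and the reduction of parts X-a…X-d
produce the expected answer where the answer is classical, nothing more. (2) The first rung with Hodge-theoretic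
content is `d = 2`, `p = 1` (compact abelian-surface pencils `𝒳³ → S`: `W ∈ H²(𝒳)` with `W ∪ [𝒳_t] = 0 ∈ H⁴(𝒳)`
must die on `𝒳_t`) — this IS Deligne's theorem (degeneration + semisimplicity; false for non-Kähler
fibrations, cf. the Hopf fibration), not reachable by the elementary arguments of this part; (κ) stays a
supply node there, and part X-d's `d = 2` rung additionally needs the codimension-2 Hodge classes of the
sixfold `𝒳 × 𝒳`. (3) (φ) is not proved here: on the carriers `[𝒳_t] = K_t · f^*[t]` is available only up to a
scalar `K_t ≠ 0` (`complexGysin_cleanBaseChange`, `exists_complexGysin_fiberι_one_eq_smul_map`); pinning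
`K_t = 1` is the local degree of holomorphic maps for the complex orientations (Fulton 19.1.2), not in the
tree.

References: DeligneHodgeII1971 (Thm. 4.1.1, 4.2.6); HatcherAT2002 (§3.3 Thm. 3.26, Thm. 3.30, Prop. 3.38);
FultonYoungTableaux1997 (App. B (5)–(6)); GriffithsHarrisPrinciples1978 (Ch. 0 §7, Wirtinger);
VoisinHodgeI2002 (§7.3.2, §11.1.2, Thm. 11.30); Abdulali1994FamiliesAV (Conj. 5.3, Thm. 5.5);
Andre1996Motifs (§5.1, §6.3 Remarque 2); SGA1 (XII Prop. 2.4).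
-/

noncomputable section

set_option linter.dupNamespace false

namespace Summit.HodgeConjecture.HodgeConjecture.Ring2.AbelianAll

open CategoryTheory AlgebraicGeometry MonoidalCategory
open Literature.AlgebraicGeometry Literature.AlgebraicGeometry.Motives
open Literature.AlgebraicGeometry.HodgeTheory
open Literature.AlgebraicTopology.SingularHomology (singularCohomology cupProduct cupPairing
  isPerfPair_cupPairing_of_field_holds)
open Summit.HodgeConjecture.HodgeConjecture
open Summit.HodgeConjecture.HodgeConjecture.Theses

variable {𝒳 S : SchemeOver ℂ}

/-! ## §1 The fibre class is non-zero -/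

/-- **`[𝒳_t] = j_{t*} 1 ≠ 0` in `H²(𝒳(ℂ); ℂ)`** for every fibre of a compact pencil of abelian varieties:
`j_t : 𝒳_t ⟶ 𝒳` is a closed immersion (base change of the closed point `t` of the separated `S`), the fibre
`𝒳_t(ℂ)` is non-empty (connected, SGA1 XII 2.4), and a closed immersion of smooth projective varieties pushes
`1` forward to a non-zero class (Wirtinger; the tree's `complexGysin_one_ne_zero_of_stalkMap_surjective`).
[cite: GriffithsHarrisPrinciples1978, Ch. 0 §7 pp. 109–111] [cite: FultonYoungTableaux1997, Appendix B §B.1 (5)] -/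
theorem fiberGysin_one_ne_zero {d : ℕ} {f : 𝒳 ⟶ S} (hf : IsCompactAbelianPencil f d) (t : ComplexPoints S) :
    fiberGysin hf t 0 (singularCohomology.one ℂ (ComplexPoints (fiberOver f t))) ≠ 0 := by
  haveI : IsProper S.hom := IsSmoothProjective.isProper_holds hf.isSmoothProjective_base
  haveI : IsClosedImmersion (fiberι f t).left := isClosedImmersion_fiberι_left f t
  haveI := connectedSpace_complexPoints (hf.isSmoothProjective_fiberOver t)
  obtain ⟨P⟩ : Nonempty (ComplexPoints (fiberOver f t)) := inferInstance
  exact complexGysin_one_ne_zero_of_stalkMap_surjective complexOrientationFamily hf.isSmoothProjective_total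
    (hf.isSmoothProjective_fiberOver t) (fiberι f t) P ((fiberι f t).left.stalkMap_surjective P.pt)
    (e := 1) (by omega)

/-! ## §2 Degree `0`: `H⁰(𝒳(ℂ); ℂ) = ℂ · 1` -/

/-- **Degree `0` of the kernel identity, same fibre**: for `W ∈ H⁰(𝒳(ℂ); ℂ)`, if `j_{t*} j_t^* W = 0` then
`j_t^* W = 0`. Indeed `W = c · 1` (`𝒳(ℂ)` is connected: `exists_eq_smul_one`), `j_t^* 1 = 1`, and
`j_{t*}(c · 1) = c · [𝒳_t]` with `[𝒳_t] ≠ 0` (§1), so `c = 0`. [cite: HatcherAT2002, §3.3 Thm. 3.26 and Prop. 3.10]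
[cite: SGA1, Exp. XII Prop. 2.4] -/
theorem map_fiberι_eq_zero_of_fiberGysin_eq_zero_zero {d : ℕ} {f : 𝒳 ⟶ S} (hf : IsCompactAbelianPencil f d)
    (t : ComplexPoints S) (W : complexBetti 𝒳 (2 * 0))
    (h : fiberGysin hf t 0 (complexBetti.map (fiberι f t) (2 * 0) W) = 0) :
    complexBetti.map (fiberι f t) (2 * 0) W = 0 := by
  obtain ⟨c, hc⟩ := exists_eq_smul_one complexOrientationFamily hf.isSmoothProjective_total W
  have h1 : complexBetti.map (fiberι f t) (2 * 0) W =
      c • singularCohomology.one ℂ (ComplexPoints (fiberOver f t)) := by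
    rw [hc, map_smul]
    exact congrArg (c • ·) (singularCohomology.map_one (R := ℂ) (Motives.AlgPoints.mapContinuous (L := ℂ) (fiberι f t)))
  rw [h1, map_smul] at h
  rcases smul_eq_zero.1 h with hc0 | h0
  · rw [h1, hc0, zero_smul]
  · exact (fiberGysin_one_ne_zero hf t h0).elim

/-! ## §3 Degree `d`: the top-degree Gysin map of a fibre is injective -/

/-- **Some `x ∈ H^{2d}(𝒳(ℂ); ℂ)` has `x ∪ [𝒳_t] = j_{t*} j_t^* x ≠ 0`**: the cup pairing
`H^{2d} × H² → H^{2d+2} → ℂ` of the closed oriented `(2d+2)`-manifold `𝒳(ℂ)` is perfect over the field `ℂ`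
(Hatcher Prop. 3.38, the tree's `isPerfPair_cupPairing_of_field_holds`), and `[𝒳_t] ≠ 0` (§1); the identity
`j_{t*} j_t^* x = x ∪ j_{t*} 1` is part V's projection formula. [cite: HatcherAT2002, §3.3 Prop. 3.38]
[cite: FultonYoungTableaux1997, Appendix B §B.1 (6)] -/
theorem exists_fiberGysin_map_fiberι_top_ne_zero {d : ℕ} {f : 𝒳 ⟶ S} (hf : IsCompactAbelianPencil f d)
    (t : ComplexPoints S) :
    ∃ x : complexBetti 𝒳 (2 * d), fiberGysin hf t d (complexBetti.map (fiberι f t) (2 * d) x) ≠ 0 := by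
  have h𝒳 := hf.isSmoothProjective_total
  by_contra hall
  push Not at hall
  apply fiberGysin_one_ne_zero hf t
  letI := h𝒳.chartedSpace
  haveI := Motives.ComplexPoints.compactSpace_of_isSmoothProjective h𝒳
  haveI := Motives.ComplexPoints.t2Space_of_isSmoothProjective h𝒳
  have hdeg : 2 * d + 2 * (0 + 1) = 2 * (d + 1) := by ring
  have hP : (cupPairing (complexOrientationFamily h𝒳) hdeg).IsPerfPair := isPerfPair_cupPairing_of_field_holds
  refine (LinearMap.IsPerfPair.bijective_right (cupPairing (complexOrientationFamily h𝒳) hdeg)).1 ?_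
  rw [map_zero]
  ext x
  rw [LinearMap.flip_apply, LinearMap.zero_apply,
    Literature.AlgebraicTopology.SingularHomology.cupPairing_apply, ← fiberGysin_map_fiberι_eq_cupProduct hf t x,
    hall x, map_zero, LinearMap.zero_apply]

/-- **`j_{t*}` is injective on the top degree `H^{2d}(𝒳_t(ℂ); ℂ)` of every fibre**: that space is the line
through `j_t^* x` for the `x` of `exists_fiberGysin_map_fiberι_top_ne_zero` (`exists_eq_smul_of_top`), and
`j_{t*}(c · j_t^* x) = c · j_{t*} j_t^* x` vanishes only for `c = 0`. [cite: HatcherAT2002, §3.3 Thm. 3.26 and Prop. 3.38] -/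
theorem fiberGysin_top_injective {d : ℕ} {f : 𝒳 ⟶ S} (hf : IsCompactAbelianPencil f d) (t : ComplexPoints S)
    {a : complexBetti (fiberOver f t) (2 * d)} (ha : fiberGysin hf t d a = 0) : a = 0 := by
  obtain ⟨x, hx⟩ := exists_fiberGysin_map_fiberι_top_ne_zero hf t
  have hx0 : complexBetti.map (fiberι f t) (2 * d) x ≠ 0 := by
    intro h0
    exact hx (by rw [h0, map_zero])
  obtain ⟨c, rfl⟩ := exists_eq_smul_of_top complexOrientationFamily (hf.isSmoothProjective_fiberOver t) hx0 a
  rw [map_smul] at ha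
  rcases smul_eq_zero.1 ha with hc | h
  · rw [hc, zero_smul]
  · exact (hx h).elim

/-- Top degree of the kernel identity, same fibre: `j_{t*} j_t^* W = 0 ⟹ j_t^* W = 0` for `W ∈ H^{2d}(𝒳(ℂ); ℂ)`.
[cite: HatcherAT2002, §3.3 Prop. 3.38] -/
theorem map_fiberι_eq_zero_of_fiberGysin_eq_zero_top {d : ℕ} {f : 𝒳 ⟶ S} (hf : IsCompactAbelianPencil f d)
    (t : ComplexPoints S) (W : complexBetti 𝒳 (2 * d))
    (h : fiberGysin hf t d (complexBetti.map (fiberι f t) (2 * d) W) = 0) :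
    complexBetti.map (fiberι f t) (2 * d) W = 0 :=
  fiberGysin_top_injective hf t h

/-! ## §4 (κ_f) in the extreme degrees, every fibre; (κ_f) outright for `d ≤ 1` -/

/-- **(κ_f) in degree `0`**: `j_{t*} j_t^* W = 0 ⟹ j_s^* W = 0` for `W ∈ H⁰(𝒳(ℂ); ℂ)` and all `t, s` (§2 at `t`,
then André's flatness (A4), the tree's `map_fiberι_eq_zero_of_eq_zero`). [cite: Andre1996Motifs, §5.1 (p. 25)]
[cite: DeligneHodgeII1971, Thm. 4.1.1] -/
theorem fibreGysinKernel_zero {d : ℕ} {f : 𝒳 ⟶ S} (hf : IsCompactAbelianPencil f d) (t s : ComplexPoints S)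
    (W : complexBetti 𝒳 (2 * 0)) (h : fiberGysin hf t 0 (complexBetti.map (fiberι f t) (2 * 0) W) = 0) :
    complexBetti.map (fiberι f s) (2 * 0) W = 0 :=
  map_fiberι_eq_zero_of_eq_zero hf (map_fiberι_eq_zero_of_fiberGysin_eq_zero_zero hf t W h) s

/-- **(κ_f) in the top degree `d`**: `j_{t*} j_t^* W = 0 ⟹ j_s^* W = 0` for `W ∈ H^{2d}(𝒳(ℂ); ℂ)` and all
`t, s` (§3 at `t`, then flatness (A4)). [cite: Andre1996Motifs, §5.1 (p. 25)] [cite: DeligneHodgeII1971, Thm. 4.1.1] -/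
theorem fibreGysinKernel_top {d : ℕ} {f : 𝒳 ⟶ S} (hf : IsCompactAbelianPencil f d) (t s : ComplexPoints S)
    (W : complexBetti 𝒳 (2 * d)) (h : fiberGysin hf t d (complexBetti.map (fiberι f t) (2 * d) W) = 0) :
    complexBetti.map (fiberι f s) (2 * d) W = 0 :=
  map_fiberι_eq_zero_of_eq_zero hf (map_fiberι_eq_zero_of_fiberGysin_eq_zero_top hf t W h) s

/-- **(κ_f) is a THEOREM for compact pencils of ELLIPTIC CURVES** (`d = 1`): the degrees are `p = 0` (§2) and
`p = 1 = d` (§3); for `p ≥ 2` the fibres have no cohomology in degree `2p`. No binder, no fact.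
[cite: DeligneHodgeII1971, Thm. 4.1.1 and 4.2.6] [cite: HatcherAT2002, §3.3 Thm. 3.26 (c) and Prop. 3.38] -/
theorem fibreGysinKernelOn_of_relDim_one {f : 𝒳 ⟶ S} (hf : IsCompactAbelianPencil f 1) : FibreGysinKernelOn hf := by
  intro p t s W hW
  rcases p with _ | _ | p
  · exact fibreGysinKernel_zero hf t s W hW
  · exact fibreGysinKernel_top hf t s W hW
  · haveI := subsingleton_complexBetti (hf.isSmoothProjective_fiberOver s) (show 2 * 1 < 2 * (p + 1 + 1) by omega)
    exact Subsingleton.elim _ _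

/-- (κ_f) is a theorem for compact pencils of relative dimension `0` (degree `p = 0` only).
[cite: DeligneHodgeII1971, Thm. 4.1.1] [cite: HatcherAT2002, §3.3 Thm. 3.26 (c)] -/
theorem fibreGysinKernelOn_of_relDim_zero {f : 𝒳 ⟶ S} (hf : IsCompactAbelianPencil f 0) : FibreGysinKernelOn hf := by
  intro p t s W hW
  rcases p with _ | p
  · exact fibreGysinKernel_zero hf t s W hW
  · haveI := subsingleton_complexBetti (hf.isSmoothProjective_fiberOver s) (show 2 * 0 < 2 * (p + 1) by omega)
    exact Subsingleton.elim _ _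

/-! ## §5 The `d ≤ 1` rungs of the Lefschetz-type node: (β′ᵖᵗ) UNCONDITIONAL, (β′) modulo (φ) alone -/

/-- **THE `d = 1` RUNG, UNCONDITIONAL: every compact pencil of elliptic curves satisfies the pointwise
fibre-class Lefschetz node (β′ᵖᵗ_f).** For each `p ≤ 1` and each fibre `𝒳_t` there is a linear map
`T_t : H^{2p+2}(𝒳(ℂ); ℂ) → H²ᵖ(𝒳(ℂ); ℂ)` INDUCED BY AN ALGEBRAIC CLASS on the fourfold `𝒳 × 𝒳`
(`IsAlgebraicCorrespondence 2 2 𝒳 𝒳 T_t`) with `j_s^*(T_t(j_{t*} j_t^* W)) = j_s^* W` for all `W` and all `s`: part X-d's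
`fibreClassLefschetzPointwiseOn_of_relDim_one` (Hodge-theoretic quasi-inverse of `∪[𝒳_t]`, part X-a; its class is
a rational `(1,1)`-class on `𝒳 × 𝒳`, algebraic by Lefschetz `(1,1)`, `lefschetzOneOne_rational_holds`) fed with
the PROVED kernel identity `fibreGysinKernelOn_of_relDim_one`. No binder, no named fact, no Hodge-conjecture input.
Degenerate in content by design (an elliptic curve has even cohomology only in degrees `0` and `2`); the first
rung with Hodge-theoretic content is `d = 2`. [cite: VoisinHodgeI2002, §11.3 Thm. 11.30]
[cite: Abdulali1994FamiliesAV, Conjecture 5.3 and Theorem 5.5 (p. 1130)] [cite: Andre1996Motifs, §6.3 Remarque 2 (p. 33)] -/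
theorem fibreClassLefschetzPointwiseOn_relDim_one {f : 𝒳 ⟶ S} (hf : IsCompactAbelianPencil f 1) :
    FibreClassLefschetzPointwiseOn hf :=
  fibreClassLefschetzPointwiseOn_of_relDim_one hf (fibreGysinKernelOn_of_relDim_one hf)

/-- **The `d = 1` rung of the one-`T` node (β′_f), modulo fibre-class constancy (φ_f) ALONE** (κ is now proved;
φ makes all `L_t = ∪[𝒳_t]` coincide so that one quasi-inverse serves every fibre). [cite: VoisinHodgeI2002, §11.3 Thm. 11.30]
[cite: Fulton1998, §19.1 proof of Prop. 19.1.1] -/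
theorem fibreClassLefschetzOn_relDim_one_of_const {f : 𝒳 ⟶ S} (hf : IsCompactAbelianPencil f 1)
    (hφ : FibreClassConstantOn hf) : FibreClassLefschetzOn hf :=
  fibreClassLefschetzOn_of_relDim_one hf (fibreGysinKernelOn_of_relDim_one hf) hφ

/-- **The graded node (β′)_1 = `FibreClassLefschetzOnAtRelDim 1` modulo (φ) alone** (part X-d had it modulo κ, φ).
[cite: VoisinHodgeI2002, §11.3 Thm. 11.30] [cite: Andre1996Motifs, §6.3 Remarque 2 (p. 33)] -/
theorem fibreClassLefschetzOnAtRelDim_one_of_const (hφ : FibreClassConstantCompactPencils) :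
    FibreClassLefschetzOnAtRelDim 1 :=
  fun _ _ _ hf _ ↦ fibreClassLefschetzOn_relDim_one_of_const hf (hφ hf)

/-- The `d = 0` rung of (β′ᵖᵗ_f), unconditional (degree `p = 0` only; `𝒳` a curve, `𝒳 × 𝒳` a surface, the
quasi-inverse algebraic by the Hodge conjecture for surfaces = Lefschetz `(1,1)`,
`hodgeConjectureFor_of_dim_le_three_holds`). Degenerate by design. [cite: VoisinHodgeI2002, §11.3 Thm. 11.30] -/
theorem fibreClassLefschetzPointwiseOn_relDim_zero {f : 𝒳 ⟶ S} (hf : IsCompactAbelianPencil f 0) :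
    FibreClassLefschetzPointwiseOn hf :=
  fibreClassLefschetzPointwiseOn_of_hodgeConjectureFor hf (fibreGysinKernelOn_of_relDim_zero hf)
    (hodgeConjectureFor_of_dim_le_three_holds (by omega)
      (IsSmoothProjective.tensor_holds hf.isSmoothProjective_total hf.isSmoothProjective_total))

/-- The `d = 0` rung of (β′_f) modulo (φ_f) alone (part X-b's `fibreClassLefschetzOn_of_relDim_zero` had κ, φ).
[cite: VoisinHodgeI2002, §11.3 Thm. 11.30] -/
theorem fibreClassLefschetzOn_relDim_zero_of_const {f : 𝒳 ⟶ S} (hf : IsCompactAbelianPencil f 0)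
    (hφ : FibreClassConstantOn hf) : FibreClassLefschetzOn hf :=
  fibreClassLefschetzOn_of_relDim_zero hf (fibreGysinKernelOn_of_relDim_zero hf) hφ

/-- **Transport on compact elliptic pencils through the Lefschetz-type node, unconditional**: (β′ᵖᵗ_f) ⟹
`InvariantCyclesHoldFor f 1` (part X-c's engine). (Also a consequence of the Hodge conjecture for the surface `𝒳`,
part VI §F; recorded to show the Lefschetz-type route closes on its first rung with no input.)
[cite: Abdulali1994FamiliesAV, (1.1) (p. 1122) and Theorem 5.5 (p. 1130)] -/
theorem invariantCyclesHoldFor_of_relDim_one {f : 𝒳 ⟶ S} (hf : IsCompactAbelianPencil f 1) :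
    Abdulali1994.InvariantCyclesHoldFor f 1 :=
  invariantCyclesHoldFor_of_fibreClassLefschetzPointwiseOn hf (fibreClassLefschetzPointwiseOn_relDim_one hf)

/-! ## §6 The state of the Lefschetz-type ladder after this part, in one statement -/

/-- **Ladder state** (each component a theorem of this part): (κ_f) in degree `0` and in the top degree `d` on
EVERY compact pencil of abelian `d`-folds; (κ_f) outright and (β′ᵖᵗ_f) UNCONDITIONALLY for `d = 1`; (β′)_1 modulo
(φ) alone. What remains a supply node: (κ) in the middle degrees `0 < p < d`, `d ≥ 2` (Deligne's theorem proper).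
[cite: DeligneHodgeII1971, Thm. 4.1.1 and 4.2.6] [cite: Andre1996Motifs, §6.3 Remarque 2 (p. 33)] -/
theorem extremeDegrees_summary :
    (∀ ⦃d : ℕ⦄ ⦃𝒳 S : SchemeOver ℂ⦄ ⦃f : 𝒳 ⟶ S⦄ (hf : IsCompactAbelianPencil f d) (t s : ComplexPoints S)
        (W : complexBetti 𝒳 (2 * 0)), fiberGysin hf t 0 (complexBetti.map (fiberι f t) (2 * 0) W) = 0 →
          complexBetti.map (fiberι f s) (2 * 0) W = 0) ∧
      (∀ ⦃d : ℕ⦄ ⦃𝒳 S : SchemeOver ℂ⦄ ⦃f : 𝒳 ⟶ S⦄ (hf : IsCompactAbelianPencil f d) (t s : ComplexPoints S)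
        (W : complexBetti 𝒳 (2 * d)), fiberGysin hf t d (complexBetti.map (fiberι f t) (2 * d) W) = 0 →
          complexBetti.map (fiberι f s) (2 * d) W = 0) ∧
      (∀ ⦃𝒳 S : SchemeOver ℂ⦄ ⦃f : 𝒳 ⟶ S⦄ (hf : IsCompactAbelianPencil f 1), FibreGysinKernelOn hf) ∧
      (∀ ⦃𝒳 S : SchemeOver ℂ⦄ ⦃f : 𝒳 ⟶ S⦄ (hf : IsCompactAbelianPencil f 1), FibreClassLefschetzPointwiseOn hf) ∧
      (FibreClassConstantCompactPencils → FibreClassLefschetzOnAtRelDim 1) :=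
  ⟨fun _ _ _ _ hf t s W h ↦ fibreGysinKernel_zero hf t s W h,
    fun _ _ _ _ hf t s W h ↦ fibreGysinKernel_top hf t s W h,
    fun _ _ _ hf ↦ fibreGysinKernelOn_of_relDim_one hf,
    fun _ _ _ hf ↦ fibreClassLefschetzPointwiseOn_relDim_one hf,
    fibreClassLefschetzOnAtRelDim_one_of_const⟩

end Summit.HodgeConjecture.HodgeConjecture.Ring2.AbelianAll

end
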